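import Literature.NumberTheory.EllipticCurves.HeegnerPointReflection
import Literature.NumberTheory.EllipticCurves.RootNumberModularityProofs
import Literature.NumberTheory.EllipticCurves.UniformizationUniqueProofs
import Literature.NumberTheory.EllipticCurves.RealLatticePeriod
import Literature.NumberTheory.EllipticCurves.EichlerIntegralFrickeProofs
import Literature.NumberTheory.EllipticCurves.HeegnerPointsImaginaryQuadraticProofs
import Literature.NumberTheory.EllipticCurves.PAdicLFunctionNonvanishingProofs
import Literature.NumberTheory.EllipticCurves.ModularSymbolsManinDrinfeldProofs
import Literature.NumberTheory.EllipticCurves.LeadingTermHeegnerProofs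
import Mathlib.NumberTheory.NumberField.Discriminant.Different
import Mathlib.NumberTheory.RamificationInertia.Basic
import HarnessLib

/-!
# Complex conjugation on the Heegner point (Darmon 2004, Prop. 3.11) from primary facts

`Literature.NumberTheory.EllipticCurves.HeegnerPointReflection` vendors, as the named fact
`Literature.NumberTheory.EllipticCurves.heegnerPoint_conj_add_rootNumber_smul`, the step of the printed proof of the
Gross–Zagier–Kolyvagin theorem over `ℚ` (Darmon, *Rational Points on Modular Elliptic Curves*,
CBMS 101 (2004), Thm. 3.22, §3.9) that descends the rank from the Heegner field `K` to `ℚ`: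
Prop. 3.11 ("`τ P_n = −sign(E, ℚ) σ P_n (mod E(H)_tors)`", proof: "See [Gr84]") for `n = 1`,
traced to `K`: for the non-trivial automorphism `σ` of `K`, `σ P_K + sign(E, ℚ) P_K` is torsion.
This file **proves** that fact (`heegnerPoint_conj_add_rootNumber_smul_of`) from primary results,
for the tree's own definitions of Heegner points (`Literature.NumberTheory.EllipticCurves.IsHeegnerPoint`: `P ↦ ∑_{[Q]} φ(τ_Q)` under
an embedding `K → ℂ`, with `φ(τ) = uniformize (c · 2πi ∫_{i∞}^τ f)`, items C17–C18) and of the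
sign (`WeierstrassCurve.rootNumber`, the sign of the functional equation of `Λ(E, s)`).

## Inputs (hypotheses of `heegnerPoint_conj_add_rootNumber_smul_of`)

* `hAL`: a newform on `Γ₀(N)` is a `w_N`-eigenvector with eigenvalue `±1` (Atkin–Lehner 1970,
  Thm. 3): the named fact `IsNewform0.exists_frickeInvolution_eq_smul` of `CuspFormLFunction.lean`
  (weight `2`, all levels) — the only unproved input;
* `hfr`: the pointwise form `f(-1/(Nτ)) = ε N τ² f(τ)` (`ModularForms.IsFrickeEigen`) of
  `w_N f = ε f` — proved in the tree (`isFrickeEigen_of_frickeInvolution_eq_smul`,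
  `PAdicLFunctionNonvanishingProofs`), kept as a hypothesis of the core theorem so that it applies
  verbatim to any `w_N`-eigenform;
* `hMD`: the Manin–Drinfeld theorem for the newform of `W` — proved in the tree for rational
  newforms (`exists_nsmul_modularSymbol_mem_periodLattice_of_isNewform0`,
  `ModularSymbolsManinDrinfeldProofs`, with `IsNewformOf.coeffField_eq_bot`), idem.

Both are discharged in the last section:

* `heegnerPoint_conj_add_rootNumber_smul_of_atkinLehner`: Prop. 3.11 from the single named fact
  `IsNewform0.exists_frickeInvolution_eq_smul` (weight `2`);
* `rank_eq_analyticRank_of_analyticRank_le_one_of_modularity_of_atkinLehner`: the named fact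
  `rank_eq_analyticRank_of_analyticRank_le_one` (Darmon 2004, Thm. 3.22: `ord_{s=1} L(E, s) ≤ 1 ⇒
  rank E(ℚ) = ord`) along the printed proof (`LeadingTermHeegnerProofs`), with its input `hτ`
  (Prop. 3.11) discharged and its inputs `hHecke`, `hAL` (Hecke's functional equation with sign,
  `ε(f) = ±1`) reduced to Atkin–Lehner's theorem
  (`IsNewform0.exists_functional_equation_two_and_of_exists_frickeInvolution_eq_smul`,
  `CuspFormLFunctionFrickeProofs`). Its remaining named inputs are primary theorems in print:
  modularity (`existsUnique_isNewformOf`, BCDT 2001), Atkin–Lehner 1970, Thm. 3, non-vanishing of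
  quadratic twists (Waldspurger 1985; Murty–Murty 1991), the Gross–Zagier formula (`gross_zagier`),
  Heegner points over `K` (`exists_isHeegnerPoint`, Gross 1984) and Kolyvagin's theorem
  (`kolyvagin`).

Used from the tree (all proved):
`Γ₀(N)`-invariance of the Eichler integral modulo periods (Manin 1972, Prop. 1.4;
`eichlerIntegral_gamma_smul_holds`, `ModularSymbolsProofs`), the Fricke transformation of the
Eichler integral (`IsFrickeEigen.eichlerIntegral_frickeGL_smul`, `EichlerIntegralFrickeProofs`;
Cremona 1997, (2.10.6), (2.11.1)), the reality of the Néron lattice of a curve over `ℚ`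
(`PeriodPair.uniformization_unique_holds`, `PeriodPair.isReal_of_g₂_g₃_real`,
`PeriodPair.IsReal.weierstrassP_conj`), `w_N` normalises `Γ₀(N)`
(`frickeGL_mul_mul_inv_mem`, `CuspFormLFunctionFrickeProofs`), and Hecke's functional equation with
the reductions of `IsNewform0.frickeInvolution_eq_smul`,
`IsNewform0.frickeEigenvalue_eq_one_or_eq_neg_one`, `IsNewform0.exists_functional_equation` to
Atkin–Lehner's theorem (ibid.).

(The same bijection-of-representatives argument discharges the named fact
`ModularForms.heegnerPointComplex_eq_of_β_eq` of `HeegnerPoints.lean` — the Heegner point does not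
depend on the chosen representatives; that is `heegnerPointComplex_eq_of_β_eq_holds` in
`HeegnerPointsProofs.lean`, not repeated here.)

## The proof (Gross 1984, §5, as cited by Darmon; Cremona 1997, §2.1.3 and §2.10)

Let `P_H = ∑_{[Q]} φ(τ_Q) ∈ E(ℂ)` be the image of `P` under `ι : K → ℂ`.
1. `ι ∘ σ = conj ∘ ι` (`comp_eq_conjugate_of_ne_id`), so `ι(σ P) = conj P_H`.
2. `φ` commutes with complex conjugation (`φ_J_smul`): the newform has real coefficients, so
   `f(-z̄) = conj f(z)` and `2πi ∫_{i∞}^{-τ̄} f = conj 2πi ∫_{i∞}^{τ} f` (`eichlerIntegral_J_smul`);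
   the Néron lattice of `W/ℚ` is real (`isReal_of_isNeronLatticeOf`, from the uniqueness of the
   lattice with the rational invariants `c₄/12, c₆/216`), so `uniformize (z̄) = conj (uniformize z)`
   (`uniformize_conj`, via `℘_Λ(z̄) = conj ℘_Λ(z)`).
   Hence `conj P_H = ∑ φ(-τ̄_Q) = ∑ φ(τ_{(A,-B,C)})`.
3. Combinatorics of Heegner forms (`HeegnerForm.negB`, `HeegnerForm.fricke`,
   `HeegnerDatum.sum_fricke_smul_eq_sum_J_smul`): `-τ̄_{(A,B,C)} = τ_{(A,-B,C)}` and
   `w_N τ_{(A,B,C)} = τ_{(CN,-B,A/N)}`; the form `(CN, B, A/N)` is again a Heegner form with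
   `B ≡ β` (primitivity uses `p ∣ N ⇒ p ∤ d_K`, which follows from the Heegner hypothesis by
   Dedekind's discriminant theorem, `not_dvd_discr_of_satisfiesHeegnerHypothesis`), so it is
   `Γ₀(N)`-equivalent to a unique representative `π Q`; `J` and `w_N` normalise `Γ₀(N)`, so
   `w_N τ_Q ∼ -τ̄_{π Q}` and `π` is a bijection of the representatives, giving
   `∑ φ(-τ̄_Q) = ∑ φ(w_N τ_Q)` by the `Γ₀(N)`-invariance of `φ`.
4. The Fricke transformation gives `∑ φ(w_N τ_Q) = ε P_H + h φ(0)` (`sum_φ_frickeGL_smul`), with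
   `φ(0)`
   torsion (`isOfFinAddOrder_cuspZeroPoint`, Manin–Drinfeld), and `w(E) = -ε` by Hecke's functional
   equation (`rootNumber_eq_neg_frickeEigenvalue`).
5. So `ι(σ P + w(E) P) = conj P_H + w(E) P_H = h φ(0)` is torsion, and `ι` is injective on `E(K)`.


## References

* [Darmon2004] H. Darmon, *Rational Points on Modular Elliptic Curves*, CBMS 101, AMS (2004),
  doi:10.1090/cbms/101 (lit store `doi-10-1090-cbms-101`): Prop. 2.11 and (2.12)–(2.17) (PDF
  pp. 29–31), Prop. 3.11 (§3.4, PDF p. 46), §3.9 (proof of Thm. 3.22, PDF pp. 50–51).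
* B. H. Gross, *Heegner points on `X₀(N)`*, in *Modular forms (Durham, 1983)*, Horwood (1984),
  87–105, §5 (cited by Darmon for the proof of Prop. 3.11; not held, not re-read).
* [CremonaAlgorithms1997] J. E. Cremona, *Algorithms for modular elliptic curves*, 2nd ed.,
  Cambridge University Press (1997); full text `https://johncremona.github.io/book/fulltext/`,
  Chapter II: §2.1.3 (real structure: `J M J = M*`, `f*(z) = conj f(-z̄)`), §2.10 (Prop. 2.10.1,
  (2.10.3), (2.10.6)), §2.11 ((2.11.1) `L(f, 1) = I_f(∞, 0)`).
* [AtkinLehner1970] A. O. L. Atkin, J. Lehner, *Hecke operators on `Γ₀(m)`*, Math. Ann. 185 (1970),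
  134–160, §2 and Thm. 3.
* [Manin1972] Ju. I. Manin, *Parabolic points and zeta functions of modular curves*, Izv. Akad.
  Nauk SSSR 36 (1972), Prop. 1.4, Cor. 3.6.
* [SilvermanAEC2009] J. H. Silverman, *The Arithmetic of Elliptic Curves*, 2nd ed., GTM 106
  (2009), Thm. VI.5.1 (PDF p. 154, lit store
  `book:silverman2009-arithmetic-elliptic-curves-2nd-ed`).
-/

noncomputable section

open scoped Classical MatrixGroups ModularForm

open CongruenceSubgroup UpperHalfPlane Complex ComplexConjugate NumberField

namespace Literature.NumberTheory.EllipticCurves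

/-! ### Involutions of Heegner forms: `(A, B, C) ↦ (A, -B, C)` and `(A, B, C) ↦ (CN, -B, A/N)`
-/

namespace HeegnerForm

variable (N : ℕ)

/-- `(A, B, C) ↦ (A, -B, C)`: the Heegner form whose CM point is `-τ̄_Q` (complex conjugation `z ↦
z* = -z̄` on `Y₀(N)`, Cremona §2.1.3). [folklore] -/
def negB (Q : ℤ × ℤ × ℤ) : ℤ × ℤ × ℤ := (Q.1, -Q.2.1, Q.2.2)

/-- `(A, B, C) ↦ (C N, -B, A / N)`: for `N ∣ A`, the Heegner form whose CM point is `w_N τ_Q = -1/(N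
τ_Q)`. [folklore] -/
def fricke (Q : ℤ × ℤ × ℤ) : ℤ × ℤ × ℤ := (Q.2.2 * N, -Q.2.1, Q.1 / N)

variable {N}

/-- The `A`-coefficient of `negB Q` is `A`. [folklore] -/
@[simp] lemma negB_fst (Q : ℤ × ℤ × ℤ) : (negB Q).1 = Q.1 := rfl
/-- The `B`-coefficient of `negB Q` is `-B`. [folklore] -/
@[simp] lemma negB_snd_fst (Q : ℤ × ℤ × ℤ) : (negB Q).2.1 = -Q.2.1 := rfl
/-- The `C`-coefficient of `negB Q` is `C`. [folklore] -/
@[simp] lemma negB_snd_snd (Q : ℤ × ℤ × ℤ) : (negB Q).2.2 = Q.2.2 := rfl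
/-- The `A`-coefficient of `fricke N Q` is `C N`. [folklore] -/
@[simp] lemma fricke_fst (Q : ℤ × ℤ × ℤ) : (fricke N Q).1 = Q.2.2 * N := rfl
/-- The `B`-coefficient of `fricke N Q` is `-B`. [folklore] -/
@[simp] lemma fricke_snd_fst (Q : ℤ × ℤ × ℤ) : (fricke N Q).2.1 = -Q.2.1 := rfl
/-- The `C`-coefficient of `fricke N Q` is `A / N`. [folklore] -/
@[simp] lemma fricke_snd_snd (Q : ℤ × ℤ × ℤ) : (fricke N Q).2.2 = Q.1 / N := rfl

/-- `(A, -B, C) ↦ (A, B, C)`: `negB` is an involution. [folklore] -/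
lemma negB_negB (Q : ℤ × ℤ × ℤ) : negB (negB Q) = Q := by
  simp [negB]

/-- `fricke` is an involution on triples with `N ∣ A`. [folklore] -/
lemma fricke_fricke {Q : ℤ × ℤ × ℤ} (hN : (N : ℤ) ≠ 0) (hQ : (N : ℤ) ∣ Q.1) :
    fricke N (fricke N Q) = Q := by
  obtain ⟨A, B, C⟩ := Q
  simp only [fricke, neg_neg, Prod.mk.injEq]
  exact ⟨Int.ediv_mul_cancel hQ, trivial, Int.mul_ediv_cancel _ hN⟩

/-- `negB` preserves the discriminant `B² - 4AC`. [folklore] -/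
lemma disc_negB (Q : ℤ × ℤ × ℤ) :
    (negB Q).2.1 ^ 2 - 4 * (negB Q).1 * (negB Q).2.2 = Q.2.1 ^ 2 - 4 * Q.1 * Q.2.2 := by
  simp [negB]

/-- `fricke` preserves the discriminant `B² - 4AC` (for `N ∣ A`). [folklore] -/
lemma disc_fricke {Q : ℤ × ℤ × ℤ} (hQ : (N : ℤ) ∣ Q.1) :
    (fricke N Q).2.1 ^ 2 - 4 * (fricke N Q).1 * (fricke N Q).2.2 = Q.2.1 ^ 2 - 4 * Q.1 * Q.2.2 := by
  simp only [fricke, even_two, Even.neg_pow]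
  rw [show 4 * (Q.2.2 * N) * (Q.1 / N) = 4 * Q.2.2 * (Q.1 / N * N) by ring, Int.ediv_mul_cancel hQ]
  ring

/-- For a positive definite form (`A > 0`, `B² - 4AC < 0`) also `C > 0`. [folklore] -/
lemma pos_snd_snd {Q : ℤ × ℤ × ℤ} (hA : 0 < Q.1) (hD : Q.2.1 ^ 2 - 4 * Q.1 * Q.2.2 < 0) :
    0 < Q.2.2 := by
  by_contra h
  push Not at h
  have : 4 * Q.1 * Q.2.2 ≤ 0 := mul_nonpos_of_nonneg_of_nonpos (by positivity) h
  nlinarith [sq_nonneg Q.2.1]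

/-- `negB` preserves the set of Heegner forms of level `N` and discriminant `D`. [folklore] -/
lemma negB_mem_heegnerForms {D : ℤ} {Q : ℤ × ℤ × ℤ} (hQ : Q ∈ heegnerForms N D) :
    negB Q ∈ heegnerForms N D := by
  obtain ⟨hdisc, hA, hNA, hprim⟩ := hQ
  refine ⟨by rw [disc_negB, hdisc], hA, hNA, fun d hd₁ hd₂ hd₃ ↦ hprim d hd₁ ?_ hd₃⟩
  simpa using hd₂

/-- If `D < 0` and no prime factor of `N` divides `D`, the Fricke image of a Heegner form of
discriminant `D` is a Heegner form of discriminant `D`. [folklore] -/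
lemma fricke_mem_heegnerForms [NeZero N] {D : ℤ} (hD0 : D < 0)
    (hND : ∀ p : ℕ, p.Prime → p ∣ N → ¬ (p : ℤ) ∣ D)
    {Q : ℤ × ℤ × ℤ} (hQ : Q ∈ heegnerForms N D) : fricke N Q ∈ heegnerForms N D := by
  obtain ⟨hdisc, hA, hNA, hprim⟩ := hQ
  have hN0 : (0 : ℤ) < N := by exact_mod_cast NeZero.pos N
  have hC : 0 < Q.2.2 := pos_snd_snd hA (hdisc ▸ hD0)
  refine ⟨by rw [disc_fricke hNA, hdisc], mul_pos hC hN0, Dvd.intro_left _ rfl, ?_⟩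
  intro d hd₁ hd₂ hd₃
  simp only [fricke_fst, fricke_snd_fst, fricke_snd_snd, dvd_neg] at hd₁ hd₂ hd₃
  by_contra hd
  have hdA : d ∣ Q.1 := (hd₃.trans (Int.ediv_dvd_of_dvd hNA) : d ∣ Q.1)
  obtain ⟨p, hp, hpd⟩ :=
    Int.exists_prime_and_dvd (fun h ↦ hd (Int.isUnit_iff_natAbs_eq.mpr h))
  -- the positive prime `p.natAbs`
  set q : ℕ := p.natAbs with hq
  have hqp : (q : ℤ) ∣ p := Int.natAbs_dvd.mpr dvd_rfl
  have hq_prime : q.Prime := Int.prime_iff_natAbs_prime.mp hp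
  have hqA : (q : ℤ) ∣ Q.1 := hqp.trans (hpd.trans hdA)
  have hqB : (q : ℤ) ∣ Q.2.1 := hqp.trans (hpd.trans hd₂)
  have hqD : (q : ℤ) ∣ D := by
    rw [← hdisc]
    exact dvd_sub (dvd_pow hqB two_ne_zero) (dvd_mul_of_dvd_left (dvd_mul_of_dvd_right hqA 4) _)
  have hqN : ¬ q ∣ N := fun h ↦ hND q hq_prime h hqD
  -- `q ∣ C N` and `q ∤ N` give `q ∣ C`
  have hqC : (q : ℤ) ∣ Q.2.2 := by
    have h1 : (q : ℤ) ∣ Q.2.2 * N := hqp.trans (hpd.trans hd₁)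
    rcases (Int.prime_iff_natAbs_prime.mpr (by simpa using hq_prime) :
      Prime (q : ℤ)).dvd_or_dvd h1 with h | h
    · exact h
    · exact absurd (Int.natCast_dvd_natCast.mp h) hqN
  have := hprim q hqA hqB hqC
  rw [Int.isUnit_iff_natAbs_eq, Int.natAbs_natCast] at this
  exact hq_prime.one_lt.ne' this

/-- The `B`-coefficient of the Fricke image of the conjugate form is `B` again. [folklore] -/
lemma negB_fricke_snd_fst (Q : ℤ × ℤ × ℤ) : (negB (fricke N Q)).2.1 = Q.2.1 := by
  simp

/-! ### The CM points of the transformed forms -/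

/-- The radicand `4AC - B²` of a positive definite form is positive (as a real number). [folklore]
-/
lemma radicand_pos {Q : ℤ × ℤ × ℤ} (hQ : Q.2.1 ^ 2 - 4 * Q.1 * Q.2.2 < 0) :
    (0 : ℝ) < 4 * Q.1 * Q.2.2 - Q.2.1 ^ 2 := by
  have : ((Q.2.1 ^ 2 - 4 * Q.1 * Q.2.2 : ℤ) : ℝ) < 0 := by exact_mod_cast hQ
  push_cast at this
  linarith

/-- `τ_Q` as a quotient: `τ_Q = (-B + i √(4AC - B²)) / (2A)`. [folklore] -/
lemma coe_heegnerTau_eq_div {Q : ℤ × ℤ × ℤ} (hA : 0 < Q.1) (hQ : Q.2.1 ^ 2 - 4 * Q.1 * Q.2.2 < 0) :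
    (heegnerTau Q : ℂ) =
      (-(Q.2.1 : ℂ) + (√(4 * Q.1 * Q.2.2 - Q.2.1 ^ 2 : ℝ) : ℂ) * Complex.I) / (2 * (Q.1 : ℂ)) := by
  have hA' : (Q.1 : ℂ) ≠ 0 := by exact_mod_cast hA.ne'
  rw [coe_heegnerTau hA hQ, Complex.mk_eq_add_mul_I]
  push_cast
  field_simp

/-- `-B + i √(4AC - B²) ≠ 0` (its imaginary part is positive). [folklore] -/
lemma num_ne_zero {Q : ℤ × ℤ × ℤ} (hQ : Q.2.1 ^ 2 - 4 * Q.1 * Q.2.2 < 0) :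
    (-(Q.2.1 : ℂ) + (√(4 * Q.1 * Q.2.2 - Q.2.1 ^ 2 : ℝ) : ℂ) * Complex.I) ≠ 0 := by
  intro h
  have := congrArg Complex.im h
  simp only [add_im, neg_im, intCast_im, neg_zero, mul_im, ofReal_re, Complex.I_im, mul_one,
    ofReal_im, Complex.I_re, mul_zero, add_zero, zero_add, zero_im] at this
  exact (Real.sqrt_pos.mpr (radicand_pos hQ)).ne' this

/-- Complex conjugation on CM points: `τ_{(A, -B, C)} = -τ̄_{(A, B, C)} = J • τ_{(A, B, C)}`.
[folklore] -/
lemma heegnerTau_negB {Q : ℤ × ℤ × ℤ} (hA : 0 < Q.1) (hQ : Q.2.1 ^ 2 - 4 * Q.1 * Q.2.2 < 0) :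
    heegnerTau (negB Q) = J • heegnerTau Q := by
  have hA' : (Q.1 : ℂ) ≠ 0 := by exact_mod_cast hA.ne'
  apply UpperHalfPlane.ext
  rw [coe_J_smul, coe_heegnerTau_eq_div hA hQ,
    coe_heegnerTau_eq_div (Q := negB Q) hA (by rwa [disc_negB])]
  have hrad : (4 * (negB Q).1 * (negB Q).2.2 - (negB Q).2.1 ^ 2 : ℝ) =
      4 * Q.1 * Q.2.2 - Q.2.1 ^ 2 := by
    simp [negB]
  rw [hrad]
  simp only [negB_snd_fst, negB_fst, Int.cast_neg, neg_neg, map_div₀, map_add, map_neg, map_mul,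
    conj_ofReal, conj_I, map_ofNat, map_intCast]
  field_simp
  ring

/-- The Fricke involution on CM points: `τ_{(CN, -B, A/N)} = -1/(N τ_{(A, B, C)}) = w_N • τ_{(A, B,
C)}`
for `N ∣ A`. [folklore] -/
lemma heegnerTau_fricke [NeZero N] {Q : ℤ × ℤ × ℤ} (hA : 0 < Q.1)
    (hQ : Q.2.1 ^ 2 - 4 * Q.1 * Q.2.2 < 0) (hNA : (N : ℤ) ∣ Q.1) :
    heegnerTau (fricke N Q) =
      ModularForms.glCast (ModularForms.frickeGL N : GL (Fin 2) ℚ) • heegnerTau Q := by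
  have hN0 : (0 : ℤ) < N := by exact_mod_cast NeZero.pos N
  have hC : 0 < Q.2.2 := pos_snd_snd hA hQ
  have hA₁ : 0 < (fricke N Q).1 := mul_pos hC hN0
  have hQ₁ : (fricke N Q).2.1 ^ 2 - 4 * (fricke N Q).1 * (fricke N Q).2.2 < 0 := by
    rwa [disc_fricke hNA]
  apply UpperHalfPlane.ext
  rw [ModularForms.coe_frickeGL_smul, coe_heegnerTau_eq_div hA₁ hQ₁, coe_heegnerTau_eq_div hA hQ]
  -- the square root is the same number `s`, with `s² = 4AC - B²`
  have hrad : (4 * (fricke N Q).1 * (fricke N Q).2.2 - (fricke N Q).2.1 ^ 2 : ℝ) =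
      4 * Q.1 * Q.2.2 - Q.2.1 ^ 2 := by
    have h' : (((fricke N Q).2.1 ^ 2 - 4 * (fricke N Q).1 * (fricke N Q).2.2 : ℤ) : ℝ) =
        ((Q.2.1 ^ 2 - 4 * Q.1 * Q.2.2 : ℤ) : ℝ) := by exact_mod_cast disc_fricke (Q := Q) hNA
    push_cast at h'
    linarith
  rw [hrad]
  set s : ℝ := √(4 * Q.1 * Q.2.2 - Q.2.1 ^ 2 : ℝ) with hs_def
  have hs : (s : ℂ) ^ 2 = 4 * Q.1 * Q.2.2 - Q.2.1 ^ 2 := by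
    have := Real.sq_sqrt (radicand_pos hQ).le
    rw [← hs_def] at this
    exact_mod_cast this
  have hA0 : (Q.1 : ℂ) ≠ 0 := by exact_mod_cast hA.ne'
  have hC0 : (Q.2.2 : ℂ) ≠ 0 := by exact_mod_cast hC.ne'
  have hN0' : (N : ℂ) ≠ 0 := by exact_mod_cast NeZero.ne N
  have hτ0 : (-(Q.2.1 : ℂ) + (s : ℂ) * Complex.I) ≠ 0 := num_ne_zero hQ
  have hprod : ((Q.2.1 : ℂ) + s * Complex.I) * (-(Q.2.1 : ℂ) + s * Complex.I) =
      -(4 * Q.1 * Q.2.2) := by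
    linear_combination (s : ℂ) ^ 2 * Complex.I_sq - hs
  simp only [fricke_fst, fricke_snd_fst, Int.cast_mul, Int.cast_neg, Int.cast_natCast, neg_neg]
  field_simp
  linear_combination hprod

end HeegnerForm

/-! ### `Γ₀(N)`-orbits on `ℍ`: compatibility with `J` and `w_N` -/

section Orbits

variable {N : ℕ}

/-- `w_N ∈ GL(2, ℝ)⁺` acting on `ℍ` (local notation for the cast of `ModularForms.frickeGL N`). -/
local notation "𝔀" => ModularForms.glCast (ModularForms.frickeGL N : GL (Fin 2) ℚ)

/-- `τ` and `τ'` lie in the same `Γ₀(N)`-orbit. [folklore] -/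
def SameOrbit (N : ℕ) (τ τ' : ℍ) : Prop :=
  ∃ γ : SL(2, ℤ), γ ∈ Gamma0 N ∧ γ • τ = τ'

/-- `SameOrbit` is reflexive. [folklore] -/
lemma SameOrbit.refl (τ : ℍ) : SameOrbit N τ τ := ⟨1, one_mem _, one_smul _ _⟩

/-- `SameOrbit` is symmetric. [folklore] -/
lemma SameOrbit.symm {τ τ' : ℍ} (h : SameOrbit N τ τ') : SameOrbit N τ' τ := by
  obtain ⟨γ, hγ, rfl⟩ := h
  exact ⟨γ⁻¹, inv_mem hγ, inv_smul_smul γ τ⟩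

/-- `SameOrbit` is transitive. [folklore] -/
lemma SameOrbit.trans {τ₁ τ₂ τ₃ : ℍ} (h₁ : SameOrbit N τ₁ τ₂) (h₂ : SameOrbit N τ₂ τ₃) :
    SameOrbit N τ₁ τ₃ := by
  obtain ⟨γ, hγ, rfl⟩ := h₁
  obtain ⟨δ, hδ, rfl⟩ := h₂
  exact ⟨δ * γ, mul_mem hδ hγ, mul_smul δ γ τ₁⟩

/-- `IsGamma0Equiv N Q Q'` says that the CM points `τ_Q, τ_{Q'}` lie in the same `Γ₀(N)`-orbit.
[folklore] -/
lemma isGamma0Equiv_iff_sameOrbit {Q Q' : ℤ × ℤ × ℤ} :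
    IsGamma0Equiv N Q Q' ↔ SameOrbit N (heegnerTau Q) (heegnerTau Q') :=
  ⟨fun ⟨γ, h⟩ ↦ ⟨γ, γ.2, h⟩, fun ⟨γ, hγ, h⟩ ↦ ⟨⟨γ, hγ⟩, h⟩⟩

/-- `J` normalises `Γ₀(N)`: `J γ J = (a, -b; -c, d)`. [cite: CremonaAlgorithms1997, §2.1.3] -/
lemma exists_J_smul_smul (γ : SL(2, ℤ)) (hγ : γ ∈ Gamma0 N) :
    ∃ γ' : SL(2, ℤ), γ' ∈ Gamma0 N ∧ ∀ τ : ℍ, J • (γ • τ) = γ' • (J • τ) := by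
  have hdet : Matrix.det !![γ 0 0, -γ 0 1; -γ 1 0, γ 1 1] = 1 := by
    have h := Matrix.SpecialLinearGroup.det_coe γ
    rw [Matrix.det_fin_two] at h
    rw [Matrix.det_fin_two_of]
    linear_combination h
  let δ : SL(2, ℤ) := ⟨!![γ 0 0, -γ 0 1; -γ 1 0, γ 1 1], hdet⟩
  refine ⟨δ, Gamma0_mem.mpr ?_, fun τ ↦ ?_⟩
  · have h10 : ((γ 1 0 : ℤ) : ZMod N) = 0 := Gamma0_mem.mp hγ
    simp [δ, h10]
  · have hJ : J * Matrix.SpecialLinearGroup.mapGL ℝ γ =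
        Matrix.SpecialLinearGroup.mapGL ℝ δ * J := by
      refine Units.ext ?_
      rw [Matrix.GeneralLinearGroup.coe_mul, Matrix.GeneralLinearGroup.coe_mul,
        Matrix.SpecialLinearGroup.mapGL_coe_matrix, Matrix.SpecialLinearGroup.mapGL_coe_matrix,
        val_J]
      ext i j
      fin_cases i <;> fin_cases j <;> simp [δ, Matrix.mul_apply, Fin.sum_univ_two]
    change J • (Matrix.SpecialLinearGroup.mapGL ℝ γ • τ) =
      Matrix.SpecialLinearGroup.mapGL ℝ δ • (J • τ)
    rw [← mul_smul, hJ, mul_smul]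

/-- `w_N` normalises `Γ₀(N)` (`ModularForms.frickeGL_mul_mul_inv_mem`), on points of `ℍ`.
[cite: AtkinLehner1970, §2] -/
lemma exists_fricke_smul_smul [NeZero N] (γ : SL(2, ℤ)) (hγ : γ ∈ Gamma0 N) :
    ∃ γ' : SL(2, ℤ), γ' ∈ Gamma0 N ∧ ∀ τ : ℍ, 𝔀 • (γ • τ) = γ' • (𝔀 • τ) := by
  have hx : Matrix.SpecialLinearGroup.mapGL ℝ γ ∈ (Gamma0 N : Subgroup (GL (Fin 2) ℝ)) :=
    Subgroup.mem_map.mpr ⟨γ, hγ, rfl⟩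
  obtain ⟨γ', hγ', h⟩ := Subgroup.mem_map.mp (ModularForms.frickeGL_mul_mul_inv_mem N hx)
  refine ⟨γ', hγ', fun τ ↦ ?_⟩
  change 𝔀 • (Matrix.SpecialLinearGroup.mapGL ℝ γ • τ) =
    Matrix.SpecialLinearGroup.mapGL ℝ γ' • (𝔀 • τ)
  rw [← mul_smul, ← mul_smul, h, inv_mul_cancel_right]

/-- `J • (J • τ) = τ` (`J² = 1`). [folklore] -/
lemma J_smul_J_smul (τ : ℍ) : J • (J • τ) = τ := by
  rw [← mul_smul, ← sq, J_sq, one_smul]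

/-- `z ↦ -z̄` descends to `Y₀(N)`: `Γ₀(N)`-equivalent points have `Γ₀(N)`-equivalent images under
`J` (Cremona §2.1.3). [cite: CremonaAlgorithms1997, §2.1.3] -/
lemma SameOrbit.J_smul {τ τ' : ℍ} (h : SameOrbit N τ τ') : SameOrbit N (J • τ) (J • τ') := by
  obtain ⟨γ, hγ, rfl⟩ := h
  obtain ⟨γ', hγ', h'⟩ := exists_J_smul_smul γ hγ
  exact ⟨γ', hγ', (h' τ).symm⟩

/-- `w_N` descends to `Y₀(N)`: `Γ₀(N)`-equivalent points have `Γ₀(N)`-equivalent images under `w_N`.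
[cite: AtkinLehner1970, §2] -/
lemma SameOrbit.fricke_smul [NeZero N] {τ τ' : ℍ} (h : SameOrbit N τ τ') :
    SameOrbit N (𝔀 • τ) (𝔀 • τ') := by
  obtain ⟨γ, hγ, rfl⟩ := h
  obtain ⟨γ', hγ', h'⟩ := exists_fricke_smul_smul γ hγ
  exact ⟨γ', hγ', (h' τ).symm⟩

/-- Converse of `SameOrbit.J_smul` (`J` is an involution). [folklore] -/
lemma SameOrbit.of_J_smul {τ τ' : ℍ} (h : SameOrbit N (J • τ) (J • τ')) : SameOrbit N τ τ' := by
  simpa only [J_smul_J_smul] using h.J_smul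

/-- Converse of `SameOrbit.fricke_smul` (`w_N` is an involution on `ℍ`). [folklore] -/
lemma SameOrbit.of_fricke_smul [NeZero N] {τ τ' : ℍ} (h : SameOrbit N (𝔀 • τ) (𝔀 • τ')) :
    SameOrbit N τ τ' := by
  simpa only [ModularForms.frickeGL_smul_frickeGL_smul] using h.fricke_smul

/-! ### The Heegner sum over `J • τ_Q` equals the Heegner sum over `w_N • τ_Q` -/

namespace HeegnerForm

/-- The CM point of `(CN, B, A/N) = negB (fricke Q)` is `J • w_N • τ_Q`. [folklore] -/
lemma heegnerTau_negB_fricke [NeZero N] {D : ℤ} (hD0 : D < 0) {Q : ℤ × ℤ × ℤ}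
    (hQ : Q ∈ heegnerForms N D) :
    heegnerTau (negB (fricke N Q)) = J • 𝔀 • heegnerTau Q := by
  obtain ⟨hdisc, hA, hNA, -⟩ := hQ
  have hQ' : Q.2.1 ^ 2 - 4 * Q.1 * Q.2.2 < 0 := hdisc ▸ hD0
  have hA₁ : 0 < (fricke N Q).1 :=
    mul_pos (pos_snd_snd hA hQ') (by exact_mod_cast NeZero.pos N)
  have hQ₁ : (fricke N Q).2.1 ^ 2 - 4 * (fricke N Q).1 * (fricke N Q).2.2 < 0 := by
    rwa [disc_fricke hNA]
  rw [heegnerTau_negB hA₁ hQ₁, heegnerTau_fricke hA hQ' hNA]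

end HeegnerForm

open HeegnerForm in
/-- **Key combinatorial step.** For a Heegner datum `H` (level `N`, discriminant `D < 0` with no
prime factor of `N` dividing `D`) and any `Γ₀(N)`-invariant function `Φ` on `ℍ`, the sums of `Φ`
over the points `w_N • τ_Q` and over the points `J • τ_Q = -τ̄_Q`, `Q` running through the
representatives, agree: both systems `{(CN, -B, A/N)}` and `{(A, -B, C)}` represent the
`Γ₀(N)`-classes of Heegner forms with `B ≡ -β`, and `Q ↦` (the representative of
`(CN, B, A/N)`) is a bijection of `H.reps` matching them. [folklore] -/
theorem HeegnerDatum.sum_fricke_smul_eq_sum_J_smul [NeZero N] {D : ℤ} (H : HeegnerDatum N D)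
    (hD0 : D < 0) (hND : ∀ p : ℕ, p.Prime → p ∣ N → ¬ (p : ℤ) ∣ D) {M : Type*} [AddCommMonoid M]
    (Φ : ℍ → M) (hΦ : ∀ γ : SL(2, ℤ), γ ∈ Gamma0 N → ∀ τ : ℍ, Φ (γ • τ) = Φ τ) :
    ∑ Q ∈ H.reps, Φ (𝔀 • heegnerTau Q) = ∑ Q ∈ H.reps, Φ (J • heegnerTau Q) := by
  have hΦ' : ∀ {τ τ' : ℍ}, SameOrbit N τ τ' → Φ τ = Φ τ' := by
    rintro τ τ' ⟨γ, hγ, rfl⟩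
    exact (hΦ γ hγ τ).symm
  -- the representative `π Q` of the class of `(CN, B, A/N)`
  have hstar : ∀ Q ∈ H.reps, ∃ Q' ∈ H.reps, IsGamma0Equiv N (negB (fricke N Q)) Q' := by
    intro Q hQ
    obtain ⟨hQf, hβ⟩ := H.mem_heegnerForms Q hQ
    exact H.exists_isGamma0Equiv _ (negB_mem_heegnerForms (fricke_mem_heegnerForms hD0 hND hQf))
      (by simpa using hβ)
  choose! π hπ_mem hπ using hstar
  have hπ' : ∀ Q ∈ H.reps, SameOrbit N (𝔀 • heegnerTau Q) (J • heegnerTau (π Q)) := by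
    intro Q hQ
    have h := (isGamma0Equiv_iff_sameOrbit.mp (hπ Q hQ)).J_smul
    rwa [heegnerTau_negB_fricke hD0 (H.mem_heegnerForms Q hQ).1, J_smul_J_smul] at h
  have hinj : Set.InjOn π H.reps := by
    intro Q₁ hQ₁ Q₂ hQ₂ h
    have h₁ := hπ' Q₁ hQ₁
    have h₂ := hπ' Q₂ hQ₂
    rw [h] at h₁
    have h₁₂ : SameOrbit N (heegnerTau Q₁) (heegnerTau Q₂) := (h₁.trans h₂.symm).of_fricke_smul
    by_contra hne
    exact H.pairwise_not_isGamma0Equiv hQ₁ hQ₂ hne (isGamma0Equiv_iff_sameOrbit.mpr h₁₂)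
  calc ∑ Q ∈ H.reps, Φ (𝔀 • heegnerTau Q)
      = ∑ Q ∈ H.reps, Φ (J • heegnerTau (π Q)) := Finset.sum_congr rfl fun Q hQ ↦ hΦ' (hπ' Q hQ)
    _ = ∑ Q ∈ H.reps, Φ (J • heegnerTau Q) :=
        Finset.sum_nbij π hπ_mem hinj (Finset.surjOn_of_injOn_of_card_le π hπ_mem hinj le_rfl)
          (fun _ _ ↦ rfl)

end Orbits

/-- **Heegner hypothesis ⇒ `gcd(d_K, N) = 1`.** If every prime `p ∣ N` splits in the quadratic
field `K` (two primes of `𝓞 K` above `p`), then no prime factor of `N` divides the discriminant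
`d_K`: by the fundamental identity `∑_{𝔓 ∣ p} e_𝔓 f_𝔓 = [K : ℚ] = 2` both primes above `p` have
`e = f = 1`, so `p` is unramified, i.e. `p ∤ d_K` (Dedekind's discriminant theorem, Mathlib
`NumberField.not_dvd_discr_iff_forall_liesOver`). [folklore] -/
theorem not_dvd_discr_of_satisfiesHeegnerHypothesis {N : ℕ} {K : Type*} [Field K] [NumberField K]
    (hK : IsImaginaryQuadratic K) (hH : SatisfiesHeegnerHypothesis N K) {p : ℕ} (hp : p.Prime)
    (hpN : p ∣ N) : ¬ (p : ℤ) ∣ NumberField.discr K := by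
  have hpZ : Prime (p : ℤ) := Nat.prime_iff_prime_int.mp hp
  rw [NumberField.not_dvd_discr_iff_forall_liesOver K (𝓞 K) hpZ]
  intro P hPmax hPover
  set 𝔭 : Ideal ℤ := Ideal.span {(p : ℤ)} with h𝔭_def
  have h𝔭0 : 𝔭 ≠ ⊥ := by
    rw [Ne, Ideal.span_singleton_eq_bot]
    exact hpZ.ne_zero
  haveI h𝔭prime : 𝔭.IsPrime := (Ideal.span_singleton_prime hpZ.ne_zero).mpr hpZ
  haveI : 𝔭.IsMaximal := h𝔭prime.isMaximal h𝔭0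
  haveI := hPmax.isPrime
  -- the fundamental identity `∑ e f = [K : ℚ] = 2` over the two primes above `p`
  have hsum := Ideal.sum_ramification_inertia (𝓞 K) ℚ K h𝔭0
  rw [hK.1] at hsum
  have hcard : (IsDedekindDomain.primesOverFinset 𝔭 (𝓞 K)).card = 2 := by
    rw [← Set.ncard_coe_finset, IsDedekindDomain.coe_primesOverFinset h𝔭0]
    exact hH p hp hpN
  have hP : P ∈ IsDedekindDomain.primesOverFinset 𝔭 (𝓞 K) :=
    (IsDedekindDomain.mem_primesOverFinset_iff h𝔭0 _).mpr ⟨hPmax.isPrime, hPover⟩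
  have hge : ∀ Q ∈ IsDedekindDomain.primesOverFinset 𝔭 (𝓞 K),
      1 ≤ 𝔭.ramificationIdx' Q * 𝔭.inertiaDeg' Q := by
    intro Q hQ
    obtain ⟨hQ₁, hQ₂⟩ := (IsDedekindDomain.mem_primesOverFinset_iff h𝔭0 _).mp hQ
    haveI := hQ₁
    haveI := hQ₂
    refine Right.one_le_mul ?_ ?_
    · exact Nat.pos_iff_ne_zero.mpr <|
        Ideal.IsDedekindDomain.ramificationIdx'_ne_zero_of_liesOver _ h𝔭0
    · exact Nat.pos_iff_ne_zero.mpr <| Ideal.inertiaDeg'_ne_zero 𝔭 Q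
  have hone : ∑ Q ∈ IsDedekindDomain.primesOverFinset 𝔭 (𝓞 K), (1 : ℕ) =
      ∑ Q ∈ IsDedekindDomain.primesOverFinset 𝔭 (𝓞 K), 𝔭.ramificationIdx' Q * 𝔭.inertiaDeg' Q := by
    rw [hsum, Finset.sum_const, smul_eq_mul, mul_one, hcard]
  have hef : 𝔭.ramificationIdx' P * 𝔭.inertiaDeg' P = 1 :=
    ((Finset.sum_eq_sum_iff_of_le hge).mp hone P hP).symm
  have he : 𝔭.ramificationIdx' P = 1 := Nat.eq_one_of_mul_eq_one_right hef
  rw [Ideal.ramificationIdx'_eq_ramificationIdx 𝔭 P h𝔭0] at he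
  exact Ideal.ramificationIdx_eq_one_iff.mp he

/-! ### The Néron lattice of a curve over `ℚ` is real -/

section Lattice

/-- **The Néron lattice of a curve over `ℚ` is stable under complex conjugation**: if `L` spans a
lattice with `g₂(L) = c₄/12`, `g₃(L) = c₆/216` for a Weierstrass model `W/ℚ` (base-changed to `ℂ`),
then `Λ̄ = Λ` (`PeriodPair.IsReal`), by the uniqueness half of the uniformization theorem
(`PeriodPair.isReal_of_g₂_g₃_real`, `PeriodPair.uniformization_unique_holds`; Silverman AEC
VI.5.1 ⇒ ATAEC §V.2), the invariants being rational. [folklore] -/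
theorem isReal_of_isNeronLatticeOf {W : WeierstrassCurve ℚ} {L : PeriodPair}
    (hL : ModularForms.IsNeronLatticeOf (W.baseChange ℂ) L) : L.IsReal := by
  obtain ⟨h₂, h₃⟩ := hL
  refine PeriodPair.isReal_of_g₂_g₃_real PeriodPair.uniformization_unique_holds ?_ ?_
  · rw [h₂]
    simp [WeierstrassCurve.baseChange, WeierstrassCurve.map_c₄]
  · rw [h₃]
    simp [WeierstrassCurve.baseChange, WeierstrassCurve.map_c₆]

end Lattice

/-! ### Complex conjugation on `E(ℂ)` and on the uniformisation -/

section Uniformize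

/-- Complex conjugation as a `ℚ`-algebra endomorphism of `ℂ`. [folklore] -/
def conjRatAlgHom : ℂ →ₐ[ℚ] ℂ := (starRingEnd ℂ : ℂ →+* ℂ).toRatAlgHom

/-- `conjRatAlgHom z = z̄`. [folklore] -/
@[simp] lemma conjRatAlgHom_apply (z : ℂ) : conjRatAlgHom z = conj z := rfl

variable {W : WeierstrassCurve ℚ}

/-- Complex conjugation on `E(ℂ) = W(ℂ)`, `(x, y) ↦ (x̄, ȳ)`, as a group homomorphism (Mathlib
`WeierstrassCurve.Affine.Point.map` along `conj : ℂ →ₐ[ℚ] ℂ`). [folklore] -/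
abbrev conjPoint (W : WeierstrassCurve ℚ) :
    (W.baseChange ℂ).toAffine.Point →+ (W.baseChange ℂ).toAffine.Point :=
  WeierstrassCurve.Affine.Point.map (W' := W) conjRatAlgHom

variable {N : ℕ} [NeZero N]

/-- **The complex uniformisation of a curve over `ℚ` commutes with complex conjugation**:
`uniformize (z̄) = conj (uniformize z)`, because the Néron lattice `Λ_E` is conjugation-stable
(`isReal_of_isNeronLatticeOf`), `℘_Λ(z̄) = conj ℘_Λ(z)`, `℘'_Λ(z̄) = conj ℘'_Λ(z)`, and
the
coefficients `a₁, a₃, b₂` of `W` are rational. [folklore] -/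
theorem uniformize_conj (Dt : ModularForms.ModularParametrizationData W N) (z : ℂ) :
    Dt.uniformize (conj z) = conjPoint W (Dt.uniformize z) := by
  have hΛ : Dt.L.IsReal := isReal_of_isNeronLatticeOf Dt.isNeronLattice
  by_cases hz : z ∈ Dt.L.lattice
  · rw [(Dt.uniformize_eq_zero_iff z).mpr hz, (Dt.uniformize_eq_zero_iff _).mpr (hΛ z hz),
      map_zero]
  · have hz' : conj z ∉ Dt.L.lattice := fun h ↦ hz (by simpa using hΛ _ h)
    obtain ⟨h₁, e₁⟩ := Dt.uniformize_spec z hz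
    obtain ⟨h₂, e₂⟩ := Dt.uniformize_spec (conj z) hz'
    rw [e₁, e₂, WeierstrassCurve.Affine.Point.map_some, WeierstrassCurve.Affine.Point.some.injEq]
    have hb₂ : conj (W.baseChange ℂ).b₂ = (W.baseChange ℂ).b₂ := by
      simp [WeierstrassCurve.baseChange, WeierstrassCurve.map_b₂]
    have ha₁ : conj (W.baseChange ℂ).a₁ = (W.baseChange ℂ).a₁ := by
      simp [WeierstrassCurve.baseChange]
    have ha₃ : conj (W.baseChange ℂ).a₃ = (W.baseChange ℂ).a₃ := by
      simp [WeierstrassCurve.baseChange]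
    refine ⟨?_, ?_⟩
    · rw [conjRatAlgHom_apply, map_sub, map_div₀, hΛ.weierstrassP_conj, hb₂, map_ofNat]
    · rw [conjRatAlgHom_apply, map_div₀, map_sub, map_sub, map_mul, map_sub, map_div₀,
        hΛ.weierstrassP_conj, hΛ.derivWeierstrassP_conj, hb₂, ha₁, ha₃, map_ofNat, map_ofNat]

end Uniformize

/-! ### Cusp forms with real Fourier coefficients: `f(-τ̄) = conj f(τ)` -/

section RealCoefficients

variable {N : ℕ} {k : ℤ}

/-- `q(-τ̄) = conj q(τ)` for `q = e^{2πiτ}`. [folklore] -/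
lemma qParam_J_smul (τ : ℍ) : Function.Periodic.qParam 1 (↑(J • τ) : ℂ) =
    conj (Function.Periodic.qParam 1 (τ : ℂ)) := by
  rw [coe_J_smul, Function.Periodic.qParam, Function.Periodic.qParam, ← Complex.exp_conj]
  congr 1
  simp only [map_div₀, map_mul, map_ofNat, conj_ofReal, conj_I]
  ring

/-- A cusp form on `Γ₀(N)` with real Fourier coefficients satisfies `f(-τ̄) = conj f(τ)`, i.e.
`f(J • τ) = conj f(τ)` (`q`-expansion principle: `q(-τ̄) = conj q(τ)`).
[cite: CremonaAlgorithms1997, §2.1.3] -/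
theorem apply_J_smul_of_conj_cuspCoeff (f : CuspForm (Gamma0 N) k)
    (hf : ∀ n, conj (ModularForms.cuspCoeff f n) = ModularForms.cuspCoeff f n) (τ : ℍ) :
    f (J • τ) = conj (f τ) := by
  have hΓ : (1 : ℝ) ∈ (Gamma0 N : Subgroup (GL (Fin 2) ℝ)).strictPeriods :=
    strictWidthInfty_Gamma0 N ▸ Subgroup.strictWidthInfty_mem_strictPeriods _
  haveI : Fact (IsCusp OnePoint.infty (Gamma0 N : Subgroup (GL (Fin 2) ℝ))) :=
    ⟨Subgroup.isCusp_of_mem_strictPeriods one_pos hΓ⟩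
  have hs := fun τ ↦ UpperHalfPlane.hasSum_qExpansion one_pos
    (SlashInvariantFormClass.periodic_comp_ofComplex f hΓ) (ModularFormClass.holo f)
    (ModularFormClass.bdd_at_infty f) τ
  refine (hs (J • τ)).unique ?_
  have h := Complex.hasSum_conj'.mpr (hs τ)
  convert h using 2 with n
  rw [qParam_J_smul, smul_eq_mul, smul_eq_mul, map_mul, map_pow]
  congr 1
  exact (hf n).symm

/-- **The Eichler integral of a real-coefficient cusp form commutes with complex conjugation**:
`2πi ∫_{i∞}^{-τ̄} f = conj (2πi ∫_{i∞}^{τ} f)`, i.e.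
`eichlerIntegral f (J • τ) = conj (eichlerIntegral f τ)` (the vertical ray above `-τ̄` is the
mirror image of the ray above `τ`, on which `f(-z̄) = conj f(z)`).
[cite: CremonaAlgorithms1997, §2.1.3] -/
theorem eichlerIntegral_J_smul (f : CuspForm (Gamma0 N) 2)
    (hf : ∀ n, conj (ModularForms.cuspCoeff f n) = ModularForms.cuspCoeff f n) (τ : ℍ) :
    ModularForms.eichlerIntegral f (J • τ) = conj (ModularForms.eichlerIntegral f τ) := by
  rw [ModularForms.eichlerIntegral, ModularForms.eichlerIntegral, map_mul, ← integral_conj]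
  simp only [map_mul, map_ofNat, conj_ofReal]
  congr 1
  refine MeasureTheory.setIntegral_congr_fun measurableSet_Ioi fun t (ht : 0 < t) ↦ ?_
  have him : 0 < ((τ : ℂ) + t * Complex.I).im := by simpa using add_pos τ.im_pos ht
  set τ' : ℍ := ⟨(τ : ℂ) + t * Complex.I, him⟩ with hτ'
  have h1 : UpperHalfPlane.ofComplex ((τ : ℂ) + t * Complex.I) = τ' :=
    UpperHalfPlane.ofComplex_apply_of_im_pos him
  have h2 : UpperHalfPlane.ofComplex (↑(J • τ) + t * Complex.I) = J • τ' := by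
    rw [J_smul τ', coe_J_smul]
    congr 1
    change -conj (τ : ℂ) + t * Complex.I = -conj ((τ : ℂ) + t * Complex.I)
    simp only [map_add, map_mul, conj_ofReal, conj_I]
    ring
  simp only [h1, h2]
  exact apply_J_smul_of_conj_cuspCoeff f hf τ'

end RealCoefficients

/-! ### Complex conjugation on the modular parametrisation and on the Heegner point -/

section Parametrization

variable {N : ℕ} [NeZero N] {W : WeierstrassCurve ℚ}

/-- The newform of `W` has real (indeed integral) Fourier coefficients `aₙ(f) = aₙ(W)`. [folklore]
-/
lemma conj_cuspCoeff_of_isNewformOf {f : CuspForm (Gamma0 N) 2} (hf : ModularForms.IsNewformOf W f)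
    (n : ℕ) : conj (ModularForms.cuspCoeff f n) = ModularForms.cuspCoeff f n := by
  rw [hf.2 n, map_intCast]

/-- **`φ(-τ̄) = conj φ(τ)`**: the modular parametrisation of a curve over `ℚ` commutes with complex
conjugation (`eichlerIntegral_J_smul`, `uniformize_conj`, and `c ∈ ℤ`). [folklore] -/
theorem φ_J_smul
    (Dt : ModularForms.ModularParametrizationData W N) (τ : ℍ) :
    Dt.φ (J • τ) = conjPoint W (Dt.φ τ) := by
  rw [ModularForms.ModularParametrizationData.φ, ModularForms.ModularParametrizationData.φ,
    eichlerIntegral_J_smul Dt.f (conj_cuspCoeff_of_isNewformOf Dt.isNewformOf) τ,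
    show (Dt.c : ℂ) * conj (ModularForms.eichlerIntegral Dt.f τ) =
      conj ((Dt.c : ℂ) * ModularForms.eichlerIntegral Dt.f τ) by rw [map_mul, map_intCast],
    uniformize_conj Dt]

/-- **Complex conjugation of the Heegner point**: `conj (∑_{[Q]} φ(τ_Q)) = ∑_{[Q]} φ(J • τ_Q)`,
i.e. `P̄_β = ∑ φ(τ_{(A,-B,C)}) = P_{-β}`. [folklore] -/
theorem conjPoint_heegnerPointComplex
    (Dt : ModularForms.ModularParametrizationData W N) {D : ℤ} (H : HeegnerDatum N D) :
    conjPoint W (ModularForms.heegnerPointComplex Dt H) =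
      ∑ Q ∈ H.reps, Dt.φ (J • heegnerTau Q) := by
  rw [ModularForms.heegnerPointComplex, map_sum]
  exact Finset.sum_congr rfl fun Q _ ↦ (φ_J_smul Dt (heegnerTau Q)).symm

end Parametrization

/-! ### The Fricke involution on the Eichler integral and on `φ` -/

section Fricke

open ModularForms

variable {N : ℕ} [NeZero N]

variable {W : WeierstrassCurve ℚ}

/-- The image `φ(0) = uniformize (c · {∞, 0}_f)` of the cusp `0` under the modular parametrisation.
[folklore] -/
def ModularForms.ModularParametrizationData.cuspZeroPoint (Dt : ModularParametrizationData W N) :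
    (W.baseChange ℂ).toAffine.Point :=
  Dt.uniformize ((Dt.c : ℂ) * modularSymbol Dt.f 0)

/-- **`φ(0)` is a torsion point** (Manin–Drinfeld): `n {∞, 0}_f ∈ Λ_f` for some `n ≥ 1`
(`exists_nsmul_modularSymbol_mem_periodLattice`), and `c Λ_f ⊆ Λ_E = ker (uniformize)`.
[cite: Manin1972, Cor. 3.6] -/
theorem isOfFinAddOrder_cuspZeroPoint (Dt : ModularParametrizationData W N)
    (hMD : exists_nsmul_modularSymbol_mem_periodLattice Dt.f) :
    IsOfFinAddOrder Dt.cuspZeroPoint := by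
  obtain ⟨n, hn, hmem⟩ := hMD 0
  refine isOfFinAddOrder_iff_nsmul_eq_zero.mpr ⟨n, hn, ?_⟩
  rw [ModularParametrizationData.cuspZeroPoint, ← map_nsmul, Dt.uniformize_eq_zero_iff,
    nsmul_eq_mul, ← mul_assoc, mul_comm (n : ℂ), mul_assoc, ← nsmul_eq_mul]
  exact Dt.smul_periodLattice_le _ hmem

/-- **`φ(w_N τ) = ε φ(τ) + φ(0)`** for the modular parametrisation, from the Fricke transformation
of the Eichler integral (`IsFrickeEigen.eichlerIntegral_frickeGL_smul`, Cremona §2.10 (2.10.6)),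
for `f` with the pointwise Fricke eigen-property with eigenvalue `ε = e ∈ ℤ`.
[cite: CremonaAlgorithms1997, §2.10 (2.10.6)] -/
theorem φ_frickeGL_smul (Dt : ModularParametrizationData W N) {e : ℤ}
    (hW : IsFrickeEigen N Dt.f (e : ℂ)) (τ : ℍ) :
    Dt.φ (glCast (frickeGL N : GL (Fin 2) ℚ) • τ) = e • Dt.φ τ + Dt.cuspZeroPoint := by
  rw [ModularParametrizationData.φ, ModularParametrizationData.φ,
    ModularParametrizationData.cuspZeroPoint, hW.eichlerIntegral_frickeGL_smul τ, mul_add,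
    map_add, ← map_zsmul]
  congr 2
  rw [zsmul_eq_mul]
  ring

/-- The Heegner sum over the points `w_N • τ_Q`: `∑_{[Q]} φ(w_N τ_Q) = ε P + h · φ(0)` with
`h = #H.reps`, from `φ_frickeGL_smul`. [folklore] -/
theorem sum_φ_frickeGL_smul (Dt : ModularParametrizationData W N) {e : ℤ}
    (hW : IsFrickeEigen N Dt.f (e : ℂ)) {D : ℤ} (H : HeegnerDatum N D) :
    ∑ Q ∈ H.reps, Dt.φ (glCast (frickeGL N : GL (Fin 2) ℚ) • heegnerTau Q) =
      e • heegnerPointComplex Dt H + H.reps.card • Dt.cuspZeroPoint := by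
  simp_rw [φ_frickeGL_smul Dt hW, Finset.sum_add_distrib, Finset.sum_const, heegnerPointComplex,
    Finset.smul_sum]

end Fricke

/-! ### The root number is minus the Fricke eigenvalue -/

section RootNumber

open ModularForms

variable {W : WeierstrassCurve ℚ}

/-- **`w(E) = -ε(f)`**: for the newform `f` of an elliptic `W/ℚ` (at level `N_W`), Hecke's
functional
equation `Λ(f, s) = i² ε(f) Λ(f, 2 - s)` (`IsNewform0.exists_functional_equation`) transported to
`Λ(W, s)` (`hasFunctionalEquationSign_of_isNewformOf`) gives the sign `-ε(f)`, and the sign is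
unique (`hasFunctionalEquationSign_unique_holds`); `ε(f) = ±1` by Atkin–Lehner.
[cite: Darmon2004, (2.13)–(2.14) and (2.17)] -/
theorem rootNumber_eq_neg_frickeEigenvalue [W.IsElliptic] [NeZero (W.conductorNorm ℤ)]
    (hHecke : ∀ (N : ℕ) [NeZero N], IsNewform0.exists_functional_equation (N := N) (k := (2 : ℤ)))
    (hAL : ∀ (N : ℕ) [NeZero N],
      IsNewform0.frickeEigenvalue_eq_one_or_eq_neg_one (N := N) (k := (2 : ℤ)))
    {f : CuspForm (Gamma0 (W.conductorNorm ℤ)) 2} (hf : IsNewformOf W f) :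
    (W.rootNumber : ℂ) = -frickeEigenvalue f := by
  have hE : W.HasEntireLFunction :=
    WeierstrassCurve.hasEntireLFunction_of_cuspCoeff_eq (strictWidthInfty_Gamma0 _) W f hf.2
  obtain ⟨Λ, hΛ, hfe⟩ := hHecke _ hf.1
  have key : ∀ w : ℤ, (w : ℂ) = -frickeEigenvalue f → W.HasFunctionalEquationSign w :=
    fun w hw ↦ W.hasFunctionalEquationSign_of_isNewformOf hE hf hΛ hfe hw
  rcases hAL _ hf.1 with h1 | h1
  · have h : W.HasFunctionalEquationSign (-1) := key (-1) (by rw [h1]; push_cast; ring)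
    have hr : W.rootNumber = -1 := by
      unfold WeierstrassCurve.rootNumber
      rw [if_pos h]
    rw [hr, h1]
    push_cast
    ring
  · have h : W.HasFunctionalEquationSign 1 := key 1 (by rw [h1]; push_cast; ring)
    have hr : W.rootNumber = 1 := by
      unfold WeierstrassCurve.rootNumber
      rw [if_neg]
      intro h'
      exact absurd (W.hasFunctionalEquationSign_unique_holds h h') (by norm_num)
    rw [hr, h1]
    push_cast
    ring

end RootNumber

/-! ### Embeddings of an imaginary quadratic field -/

section Embeddings

variable {K : Type*} [Field K] [NumberField K]

/-- For an imaginary quadratic field `K`, an embedding `ι : K → ℂ` and the non-trivial automorphism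
`σ` of `K`: `ι ∘ σ = conj ∘ ι` (both are embeddings different from `ι` — `σ ≠ id`, and `ι` is not
real because `K` is totally complex — and `K` has exactly `[K : ℚ] = 2` complex embeddings).
[folklore] -/
theorem comp_eq_conjugate_of_ne_id (hK : IsImaginaryQuadratic K) (ι : K →+* ℂ) {σ : K →ₐ[ℚ] K}
    (hσ : σ ≠ AlgHom.id ℚ K) : ι.comp (σ : K →+* K) = NumberField.ComplexEmbedding.conjugate ι := by
  haveI := hK.2
  -- three `ℚ`-algebra maps `K → ℂ`: `ι`, `ι ∘ σ`, `conj ∘ ι`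
  let ι₀ : K →ₐ[ℚ] ℂ := ι.toRatAlgHom
  let ι₁ : K →ₐ[ℚ] ℂ := (ι.comp (σ : K →+* K)).toRatAlgHom
  let ι₂ : K →ₐ[ℚ] ℂ := (NumberField.ComplexEmbedding.conjugate ι).toRatAlgHom
  have h10 : ι₁ ≠ ι₀ := by
    intro h
    apply hσ
    ext x
    have := congrArg (fun g : K →ₐ[ℚ] ℂ ↦ g x) h
    exact ι.injective this
  have h20 : ι₂ ≠ ι₀ := by
    intro h
    apply NumberField.IsTotallyComplex.complexEmbedding_not_isReal (K := K) ι
    rw [NumberField.ComplexEmbedding.isReal_iff]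
    exact RingHom.ext fun x ↦ congrArg (fun g : K →ₐ[ℚ] ℂ ↦ g x) h
  have hcard : Fintype.card (K →ₐ[ℚ] ℂ) = 2 := by rw [AlgHom.card, hK.1]
  -- pigeonhole: `ι₁ = ι₂`
  have h12 : ι₁ = ι₂ := by
    by_contra h
    have h3 : ({ι₀, ι₁, ι₂} : Finset (K →ₐ[ℚ] ℂ)).card = 3 := by
      rw [Finset.card_insert_of_notMem (by simp [h10.symm, h20.symm]),
        Finset.card_insert_of_notMem (by simpa using h), Finset.card_singleton]
    have := Finset.card_le_univ ({ι₀, ι₁, ι₂} : Finset (K →ₐ[ℚ] ℂ))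
    rw [h3, hcard] at this
    omega
  exact RingHom.ext fun x ↦ congrArg (fun g : K →ₐ[ℚ] ℂ ↦ g x) h12

end Embeddings

/-! ### Assembly: Darmon's Proposition 3.11 -/

section Assembly

open ModularForms

/-- **Darmon 2004, Prop. 3.11 (complex conjugation on `P_K`), proved** up to Atkin–Lehner's
theorem. The named fact `Literature.NumberTheory.EllipticCurves.heegnerPoint_conj_add_rootNumber_smul` — for an elliptic curve `E/ℚ`
(globally minimal model `W`, conductor `N`), an imaginary quadratic `K` with the Heegner hypothesis,
a Heegner point `P ∈ E(K)` of level `N` and the non-trivial automorphism `σ` of `K`, the point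
`σ P + w(E) P` is torsion — holds given:

* `hAL`: a newform on `Γ₀(N)` is a `w_N`-eigenvector with eigenvalue `±1` (Atkin–Lehner 1970,
  Thm. 3; the named fact `IsNewform0.exists_frickeInvolution_eq_smul` of `CuspFormLFunction.lean`);
* `hfr`: the pointwise form `f(-1/(Nτ)) = ε N τ² f(τ)` of `w_N f = ε f` (proved:
  `isFrickeEigen_of_frickeInvolution_eq_smul` in `PAdicLFunctionNonvanishingProofs`, not imported
  here for weight of imports);
* `hMD`: the Manin–Drinfeld theorem for the newform of `W` (proved for rational newforms:
  `exists_nsmul_modularSymbol_mem_periodLattice_of_isNewform0` in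
  `ModularSymbolsManinDrinfeldProofs`, with `IsNewformOf.coeffField_eq_bot`; idem).

Everything else is proved in the tree: `Γ₀(N)`-invariance of `φ` (Manin 1972, Prop. 1.4,
`eichlerIntegral_gamma_smul_holds`), the Fricke transformation of the Eichler integral
(`IsFrickeEigen.eichlerIntegral_frickeGL_smul`, Cremona (2.10.6), (2.11.1)), the reality of the
Néron lattice (`PeriodPair.uniformization_unique_holds`), Hecke's functional equation
(`IsNewform0.exists_functional_equation_two_of_frickeInvolution_eq_smul`) and `w(E) = -ε`
(`rootNumber_eq_neg_frickeEigenvalue`).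

Proof (Gross 1984, §5, as cited by Darmon; Darmon 2004, §3.4 and §3.9): writing
`P_H = ∑_{[Q]} φ(τ_Q) ∈ E(ℂ)` for the image of `P` under `ι : K → ℂ`, the other embedding
`ι ∘ σ = conj ∘ ι` sends `P` to `conj P_H = ∑ φ(-τ̄_Q)` (`φ` commutes with complex conjugation); the
classes of the forms `(A, -B, C)` (CM points `-τ̄_Q`) and `(CN, -B, A/N)` (CM points `w_N τ_Q`) are
the same `h` classes, so `∑ φ(-τ̄_Q) = ∑ φ(w_N τ_Q) = ε P_H + h φ(0)`; `φ(0)` is torsion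
(Manin–Drinfeld) and `w(E) = -ε`, so `conj P_H + w(E) P_H = h φ(0)` is torsion, and `ι` is
injective on `E(K)`. [cite: Darmon2004, Prop. 3.11 and §3.9] -/
theorem heegnerPoint_conj_add_rootNumber_smul_of
    (hAL : ∀ (N : ℕ) [NeZero N], IsNewform0.exists_frickeInvolution_eq_smul (N := N) (k := (2 : ℤ)))
    (hfr : ∀ (N : ℕ) [NeZero N] (f : CuspForm (Gamma0 N) 2) (ε : ℂ),
      frickeInvolution N 2 f = ε • f → IsFrickeEigen N f ε)
    (hMD : ∀ (N : ℕ) [NeZero N] (W : WeierstrassCurve ℚ) (f : CuspForm (Gamma0 N) 2),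
      IsNewformOf W f → exists_nsmul_modularSymbol_mem_periodLattice f) :
    heegnerPoint_conj_add_rootNumber_smul := by
  intro W _ _ _ K _ _ hK hH P hP σ hσ
  obtain ⟨Dt, H, ι, hPH⟩ := hP
  -- Atkin–Lehner: `w_N f = ε f`, `ε = ε(f) = ±1`, as an integer `e`
  have hw : frickeInvolution (W.conductorNorm ℤ) 2 Dt.f = frickeEigenvalue Dt.f • Dt.f :=
    IsNewform0.frickeInvolution_eq_smul_of (hAL (W.conductorNorm ℤ)) Dt.isNewformOf.1
  obtain ⟨e, -, he⟩ : ∃ e : ℤ, (e = 1 ∨ e = -1) ∧ (e : ℂ) = frickeEigenvalue Dt.f := by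
    rcases IsNewform0.frickeEigenvalue_eq_one_or_eq_neg_one_of (hAL (W.conductorNorm ℤ))
      Dt.isNewformOf.1 with h | h
    · exact ⟨1, Or.inl rfl, by rw [h]; norm_num⟩
    · exact ⟨-1, Or.inr rfl, by rw [h]; norm_num⟩
  have hW : IsFrickeEigen (W.conductorNorm ℤ) Dt.f (e : ℂ) := by
    rw [he]
    exact hfr _ Dt.f _ hw
  have hroot : W.rootNumber = -e := by
    have h := rootNumber_eq_neg_frickeEigenvalue
      (IsNewform0.exists_functional_equation_two_of_frickeInvolution_eq_smul
        fun N _ ↦ IsNewform0.frickeInvolution_eq_smul_of (hAL N))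
      (fun N _ ↦ IsNewform0.frickeEigenvalue_eq_one_or_eq_neg_one_of (hAL N)) Dt.isNewformOf
    rw [← he] at h
    exact_mod_cast h
  -- `Γ₀(N)`-invariance of `φ` (Manin 1972, Prop. 1.4, proved in `ModularSymbolsProofs`)
  have hΦ : ∀ γ : SL(2, ℤ), γ ∈ Gamma0 (W.conductorNorm ℤ) → ∀ τ : ℍ, Dt.φ (γ • τ) = Dt.φ τ :=
    fun γ hγ τ ↦ Dt.φ_gamma0_smul_holds (eichlerIntegral_gamma_smul_holds Dt.f) ⟨γ, hγ⟩ τ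
  have hD0 : NumberField.discr K < 0 := hK.discr_neg
  have hND : ∀ p : ℕ, p.Prime → p ∣ W.conductorNorm ℤ → ¬ (p : ℤ) ∣ NumberField.discr K :=
    fun p hp hpN ↦ not_dvd_discr_of_satisfiesHeegnerHypothesis hK hH hp hpN
  -- the other embedding: `ι (σ P) = conj (ι P) = conj P_H`
  have hισ : WeierstrassCurve.Affine.Point.map (W' := W) ι.toRatAlgHom
      (WeierstrassCurve.Affine.Point.map (W' := W) σ P) =
      conjPoint W (heegnerPointComplex Dt H) := by
    have hcomp : ι.toRatAlgHom.comp σ = conjRatAlgHom.comp ι.toRatAlgHom := by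
      apply AlgHom.ext
      intro x
      have := RingHom.congr_fun (comp_eq_conjugate_of_ne_id hK ι hσ) x
      simpa using this
    rw [WeierstrassCurve.Affine.Point.map_map, ← hPH]
    change _ = WeierstrassCurve.Affine.Point.map (W' := W) conjRatAlgHom
      (WeierstrassCurve.Affine.Point.map (W' := W) ι.toRatAlgHom P)
    rw [WeierstrassCurve.Affine.Point.map_map, hcomp]
  -- `ι (σ P + w P) = conj P_H + w P_H = ε P_H + h φ(0) - ε P_H = h φ(0)`
  have key : WeierstrassCurve.Affine.Point.map (W' := W) ι.toRatAlgHom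
      (WeierstrassCurve.Affine.Point.map (W' := W) σ P + W.rootNumber • P) =
      H.reps.card • Dt.cuspZeroPoint := by
    rw [map_add, map_zsmul, hισ, hPH, conjPoint_heegnerPointComplex Dt H,
      ← H.sum_fricke_smul_eq_sum_J_smul hD0 hND Dt.φ hΦ, sum_φ_frickeGL_smul Dt hW H, hroot,
      neg_zsmul, add_right_comm, add_neg_cancel, zero_add]
  -- `h φ(0)` is torsion (Manin–Drinfeld), and `ι` is injective on points
  have hT : IsOfFinAddOrder (H.reps.card • Dt.cuspZeroPoint) :=
    (isOfFinAddOrder_cuspZeroPoint Dt (hMD _ W Dt.f Dt.isNewformOf)).nsmul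
  obtain ⟨n, hn, hn0⟩ := hT.exists_nsmul_eq_zero
  refine isOfFinAddOrder_iff_nsmul_eq_zero.mpr ⟨n, hn, ?_⟩
  apply WeierstrassCurve.Affine.Point.map_injective (f := ι.toRatAlgHom)
  rw [map_nsmul, key, hn0, map_zero]

end Assembly

/-! ### Prop. 3.11 from Atkin–Lehner's theorem; Thm. 3.22 along the printed proof -/

section AtkinLehner

open ModularForms

/-- **Darmon 2004, Prop. 3.11, from Atkin–Lehner's theorem alone**: the named fact
`Literature.NumberTheory.EllipticCurves.heegnerPoint_conj_add_rootNumber_smul` (complex conjugation acts on the Heegner point `P_K`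
by `-w(E)` up to torsion) follows from `IsNewform0.exists_frickeInvolution_eq_smul` in weight `2`
(a newform on `Γ₀(N)` is a `w_N`-eigenvector with eigenvalue `±1`; Atkin–Lehner 1970, Thm. 3), all
other inputs of `heegnerPoint_conj_add_rootNumber_smul_of` being proved in the tree: the pointwise
Fricke property (`isFrickeEigen_of_frickeInvolution_eq_smul`, `PAdicLFunctionNonvanishingProofs`)
and the Manin–Drinfeld theorem for rational newforms
(`exists_nsmul_modularSymbol_mem_periodLattice_of_isNewform0`, `ModularSymbolsManinDrinfeldProofs`,
with `IsNewformOf.coeffField_eq_bot`).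
[cite: Darmon2004, Prop. 3.11 and §3.9] [cite: AtkinLehner1970, Thm. 3] -/
theorem heegnerPoint_conj_add_rootNumber_smul_of_atkinLehner
    (hAL : ∀ (N : ℕ) [NeZero N],
      IsNewform0.exists_frickeInvolution_eq_smul (N := N) (k := (2 : ℤ))) :
    heegnerPoint_conj_add_rootNumber_smul :=
  heegnerPoint_conj_add_rootNumber_smul_of hAL
    (fun N _ _ _ h ↦ isFrickeEigen_of_frickeInvolution_eq_smul N h)
    (fun _ _ _ _ hf ↦
      exists_nsmul_modularSymbol_mem_periodLattice_of_isNewform0 hf.1 hf.coeffField_eq_bot)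

/-- **Darmon 2004, Thm. 3.22 along the printed proof (Heegner route), with Prop. 3.11 proved**: the
named fact `rank_eq_analyticRank_of_analyticRank_le_one` (`ord_{s=1} L(E, s) ≤ 1 ⇒ rank E(ℚ) = ord`)
from modularity (`hmod`, Breuil–Conrad–Diamond–Taylor 2001), Atkin–Lehner's theorem (`hAL`,
Atkin–Lehner 1970, Thm. 3: it supplies Hecke's functional equation with its sign, `ε(f) = ±1`, and
Prop. 3.11), non-vanishing of quadratic twists (`hWa` Waldspurger 1985, `hMM` Murty–Murty 1991),
the Gross–Zagier formula (`hGZ`), Heegner points over `K` (`hHP`, Gross 1984) and Kolyvagin's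
theorem (`hKo`) —
`rank_eq_analyticRank_of_analyticRank_le_one_of_modularity'` (`LeadingTermHeegnerProofs`) with
`hHecke`, `hAL` from
`IsNewform0.exists_functional_equation_two_and_of_exists_frickeInvolution_eq_smul` and `hτ` from
`heegnerPoint_conj_add_rootNumber_smul_of_atkinLehner`.
[cite: Darmon2004, Thm. 3.22 and §3.9] -/
theorem rank_eq_analyticRank_of_analyticRank_le_one_of_modularity_of_atkinLehner
    (hmod : existsUnique_isNewformOf)
    (hAL : ∀ (N : ℕ) [NeZero N],
      IsNewform0.exists_frickeInvolution_eq_smul (N := N) (k := (2 : ℤ)))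
    (hWa : waldspurger_exists_heegnerField_twist_ne_zero)
    (hMM : murtyMurty_exists_heegnerField_twist_simpleZero)
    (hGZ : ∀ (N : ℕ) [NeZero N] (W : WeierstrassCurve ℚ) (K : Type) [Field K] [NumberField K],
      gross_zagier N W K)
    (hHP : ∀ (W : WeierstrassCurve ℚ) (K : Type) [Field K] [NumberField K],
      exists_isHeegnerPoint W K)
    (hKo : ∀ (N : ℕ) [NeZero N] (W : WeierstrassCurve ℚ) (K : Type) [Field K] [NumberField K],
      kolyvagin N W K) :
    rank_eq_analyticRank_of_analyticRank_le_one :=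
  have h := IsNewform0.exists_functional_equation_two_and_of_exists_frickeInvolution_eq_smul hAL
  rank_eq_analyticRank_of_analyticRank_le_one_of_modularity' hmod h.1 h.2 hWa hMM hGZ hHP hKo
    (heegnerPoint_conj_add_rootNumber_smul_of_atkinLehner hAL)

end AtkinLehner

end Literature.NumberTheory.EllipticCurves

end
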